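import Summits.Ventures.PercRepro.S2GiantExactLevels

/-!
# PercRepro — THE GIANT SETS OF ALL LEVELS AND THE RANK-`q` SETS OF EVERY SIZE (p8, gen 21; a feeder for S4 — the top of the
`q = 7` window, the rows `43` and below)

The `Y`-side of every level-`7` core bounds the rank-`7` sets by `C(n, 7)·2^{min 72 d}` (a rank-`7` flat has `≤ min 79 (7 + d)`
points): at `p ≤ 43` and `66 ≤ d < D₀` that term alone exceeds the room the spanning sets leave. Here the rank-`q` sets of
size `> d` are counted through the giant flat: for `d ≥ f' + 1` and `d + 1 ≥ q + ν₁` every level-`m` set with `m > d` is giant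
(its closure has `≥ m > f' + 1` points and `≥ q + ν₁` points), and the giant sets of ALL levels `q + 1 … q + d` are subsets of
the unique giant flat (`sum_card_levelFGiant_le_all`, the range of `sum_card_levelFGiant_le` extended). Hence
**`ncard_eRk_eq_le_ncard_le_add_two_pow`**: `#{X : r(X) = q} ≤ #{X : r(X) = q, |X| ≤ d} + 2^{min f (q + d)}` — the first term
is the telescoping count's, the second is negligible. Axioms: standard.
-/

open scoped Matroid

namespace PercRepro

namespace S2

open Set Finset

variable {α : Type} {M : Matroid α}

open scoped Classical in
/-- **The giant sets of ALL levels `q + 1 … q + d` lie in ONE flat** — `sum_card_levelFGiant_le` (S2GiantExactLevels) with the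
level range extended from `d` to `q + d` (every rank-`q` set has at most `q + d` points); the proof is the same. -/
theorem sum_card_levelFGiant_le_all [M.Finite] (q f f' ν₁ νi : ℕ) (hq : 1 ≤ q)
    (hcirc : ∀ C, M.IsCircuit C → 3 ≤ C.encard) (hC1 : ∀ L ⊆ M.E, M.eRk L = 2 → L.ncard ≤ 3)
    (hC2 : ∀ L ⊆ M.E, M.eRk L ≤ 3 → L.ncard ≤ 6)
    (hflat : ∀ X ⊆ M.E, M.eRk X ≤ q → X.ncard ≤ f)
    (hflat' : ∀ X ⊆ M.E, M.eRk X ≤ (q - 1 : ℕ) → X.ncard ≤ f')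
    (hinter : ∀ X ⊆ M.E, M.eRk X ≤ (q - 1 : ℕ) → (X.ncard : ℕ∞) ≤ M.eRk X + νi)
    {d : ℕ} (hd : M.E.encard = M.eRank + d) (h2 : d + νi < 2 * ν₁) :
    ∑ m ∈ Finset.Icc (q + 1) (q + d), (levelFGiant M q f' ν₁ m).card ≤ 2 ^ (min f (q + d)) := by
  -- a giant set has a giant pair in its fibre
  have hpair : ∀ m ∈ Finset.Icc (q + 1) (q + d), ∀ B ∈ levelFGiant M q f' ν₁ m,
      ∃ p ∈ Matroid.pairsGiant M q f' ν₁, M.closure (B : Set α) = M.closure (p.1 ∪ p.2) := by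
    intro m hm B hB
    rw [Finset.mem_Icc] at hm
    unfold levelFGiant at hB
    rw [Finset.mem_filter] at hB
    obtain ⟨hBl, hBg⟩ := hB
    push Not at hBg
    obtain ⟨hBgr, hBm, hBq⟩ := Matroid.mem_levelF.1 hBl
    have hBE : (B : Set α) ⊆ M.E := by rw [← Matroid.coe_groundF]; exact_mod_cast hBgr
    have hmult := card_pairs_ge_quart q hq hcirc hC1 hC2 hBE hBq
    rw [hBm] at hmult
    have hpos : 0 < ((Matroid.pairsF M q).filter (fun p => p.1 ∪ p.2 ⊆ (B : Set α) ∧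
        (B : Set α) ⊆ M.closure (p.1 ∪ p.2))).card := by
      have : 0 < (m - q) + 3 * (m - q).choose 2 + 3 * (m - q).choose 3 + 2 * (m - q).choose 4 := by
        have : 1 ≤ m - q := by omega
        omega
      omega
    obtain ⟨p, hp⟩ := Finset.card_pos.1 hpos
    rw [Finset.mem_filter] at hp
    obtain ⟨hpF, hpB, hBp⟩ := hp
    have hcl : M.closure (B : Set α) = M.closure (p.1 ∪ p.2) := closure_eq_closure_of_fibre hpB hBp
    refine ⟨p, ?_, hcl⟩
    unfold Matroid.pairsGiant Matroid.pairsBig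
    rw [Finset.mem_filter, Finset.mem_filter]
    rw [← hcl]
    exact ⟨⟨hpF, not_le.2 hBg.1⟩, hBg.2⟩
  by_cases hex : ∃ m ∈ Finset.Icc (q + 1) (q + d), ∃ B, B ∈ levelFGiant M q f' ν₁ m
  · obtain ⟨m₀, hm₀, B₀, hB₀⟩ := hex
    obtain ⟨p₀, hp₀, hcl₀⟩ := hpair m₀ hm₀ B₀ hB₀
    -- the giant flat
    set Fg := M.closure (B₀ : Set α) with hFg
    have hFgE : Fg ⊆ M.E := M.closure_subset_ground _
    have hFgfin : Fg.Finite := M.ground_finite.subset hFgE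
    have hB₀q : M.eRk (B₀ : Set α) = (q : ℕ∞) := by
      unfold levelFGiant at hB₀
      rw [Finset.mem_filter] at hB₀
      exact (Matroid.mem_levelF.1 hB₀.1).2.2
    have hFgrk : M.eRk Fg = (q : ℕ∞) := by rw [hFg, M.eRk_closure_eq, hB₀q]
    have hFgf : Fg.ncard ≤ f := hflat Fg hFgE (by rw [hFgrk])
    have hFgd : Fg.ncard ≤ q + d := by
      have h := Matroid.encard_le_eRk_add_of_encard_eq hFgE hd
      rw [hFgrk, ← hFgfin.cast_ncard_eq] at h
      exact_mod_cast h
    have hFgmin : Fg.ncard ≤ min f (q + d) := le_min hFgf hFgd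
    -- every giant set of every level lies in the giant flat
    have hin : ∀ m ∈ Finset.Icc (q + 1) (q + d), ∀ B ∈ levelFGiant M q f' ν₁ m, B ⊆ hFgfin.toFinset := by
      intro m hm B hB
      obtain ⟨p, hp, hcl⟩ := hpair m hm B hB
      have hBE : (B : Set α) ⊆ M.E := by
        unfold levelFGiant at hB
        rw [Finset.mem_filter] at hB
        rw [← Matroid.coe_groundF]
        exact_mod_cast (Matroid.mem_levelF.1 hB.1).1
      have heq : M.closure (p.1 ∪ p.2) = M.closure (p₀.1 ∪ p₀.2) :=
        Matroid.closure_eq_of_giant hq hflat' hinter hd h2 hp hp₀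
      have hBF : (B : Set α) ⊆ Fg := by
        calc (B : Set α) ⊆ M.closure (B : Set α) := M.subset_closure _ hBE
          _ = Fg := by rw [hcl, heq, ← hcl₀]
      intro x hx
      rw [Set.Finite.mem_toFinset]
      exact hBF hx
    have hlev : ∀ m ∈ Finset.Icc (q + 1) (q + d), (levelFGiant M q f' ν₁ m).card ≤ Fg.ncard.choose m := by
      intro m hm
      have hsub : levelFGiant M q f' ν₁ m ⊆ hFgfin.toFinset.powersetCard m := by
        intro B hB
        rw [Finset.mem_powersetCard]
        refine ⟨hin m hm B hB, ?_⟩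
        unfold levelFGiant at hB
        rw [Finset.mem_filter] at hB
        exact (Matroid.mem_levelF.1 hB.1).2.1
      calc (levelFGiant M q f' ν₁ m).card ≤ (hFgfin.toFinset.powersetCard m).card := Finset.card_le_card hsub
        _ = hFgfin.toFinset.card.choose m := Finset.card_powersetCard _ _
        _ = Fg.ncard.choose m := by rw [Set.ncard_eq_toFinset_card _ hFgfin]
    calc ∑ m ∈ Finset.Icc (q + 1) (q + d), (levelFGiant M q f' ν₁ m).card
        ≤ ∑ m ∈ Finset.Icc (q + 1) (q + d), Fg.ncard.choose m := Finset.sum_le_sum hlev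
      _ ≤ 2 ^ Fg.ncard := sum_Icc_choose_le_two_pow _ _ _
      _ ≤ 2 ^ (min f (q + d)) := Nat.pow_le_pow_right (by norm_num) hFgmin
  · push Not at hex
    have hzero : ∀ m ∈ Finset.Icc (q + 1) (q + d), (levelFGiant M q f' ν₁ m).card = 0 := by
      intro m hm
      rw [Finset.card_eq_zero]
      exact Finset.eq_empty_of_forall_notMem (hex m hm)
    rw [Finset.sum_eq_zero hzero]
    exact Nat.zero_le _


open scoped Classical in
/-- The rank-`q` sets of size in `(d₁, d₂]` are covered by the levels `d₁ + 1 … d₂` (`Matroid.ncard_dep_le_sum_levelF` with a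
general lower size). -/
theorem ncard_eRk_eq_ncard_gt_le_sum_levelF [M.Finite] (q d₁ d₂ : ℕ) :
    {B : Set α | B ⊆ M.E ∧ M.eRk B = q ∧ d₁ < B.ncard ∧ B.ncard ≤ d₂}.ncard ≤
      ∑ m ∈ Finset.Icc (d₁ + 1) d₂, (Matroid.levelF M q m).card := by
  set T := (Finset.Icc (d₁ + 1) d₂).biUnion (fun m => Matroid.levelF M q m) with hT
  have hsub : {B : Set α | B ⊆ M.E ∧ M.eRk B = q ∧ d₁ < B.ncard ∧ B.ncard ≤ d₂} ⊆
      (T.image (fun s : Finset α => (s : Set α)) : Set (Set α)) := by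
    intro B hB
    have hBfin : B.Finite := M.ground_finite.subset hB.1
    rw [Finset.mem_coe, Finset.mem_image]
    refine ⟨hBfin.toFinset, ?_, by simp⟩
    rw [hT, Finset.mem_biUnion]
    have hlt := hB.2.2.1
    have hle := hB.2.2.2
    refine ⟨B.ncard, by rw [Finset.mem_Icc]; omega, ?_⟩
    rw [Matroid.mem_levelF]
    refine ⟨?_, (Set.ncard_eq_toFinset_card _ hBfin).symm, by simpa using hB.2.1⟩
    intro x hx
    rw [Set.Finite.mem_toFinset] at hx
    unfold Matroid.groundF
    rw [Set.Finite.mem_toFinset]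
    exact hB.1 hx
  calc _ ≤ (T.image (fun s : Finset α => (s : Set α)) : Set (Set α)).ncard :=
        ncard_le_ncard hsub (Finset.finite_toSet _)
    _ = (T.image (fun s : Finset α => (s : Set α))).card := Set.ncard_coe_finset _
    _ ≤ T.card := Finset.card_image_le
    _ ≤ _ := Finset.card_biUnion_le

open scoped Classical in
/-- Above the size `max (f' + 1) (q + ν₁ − 1)` every level set is giant: `levelF = levelFGiant`. -/
theorem card_levelF_eq_card_levelFGiant_of_big [M.Finite] (q f' ν₁ m : ℕ) (h1 : f' + 1 < m) (h2 : q + ν₁ ≤ m) :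
    (Matroid.levelF M q m).card = (levelFGiant M q f' ν₁ m).card := by
  have hng : levelFNonGiant M q f' ν₁ m = ∅ := by
    apply Finset.eq_empty_of_forall_notMem
    intro B hB
    unfold levelFNonGiant at hB
    rw [Finset.mem_filter] at hB
    obtain ⟨hBl, hBor⟩ := hB
    obtain ⟨hBgr, hBm, hBq⟩ := Matroid.mem_levelF.1 hBl
    have hBE : (B : Set α) ⊆ M.E := by rw [← Matroid.coe_groundF]; exact_mod_cast hBgr
    have hsub : (B : Set α) ⊆ M.closure (B : Set α) := M.subset_closure _ hBE
    have hcl : (B : Set α).ncard ≤ (M.closure (B : Set α)).ncard :=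
      Set.ncard_le_ncard hsub (M.ground_finite.subset (M.closure_subset_ground _))
    rw [Set.ncard_coe_finset, hBm] at hcl
    rcases hBor with h | h
    · omega
    · exact h (by omega)
  rw [card_levelF_eq_nonGiant_add_giant q f' ν₁ m, hng, Finset.card_empty, zero_add]

open scoped Classical in
/-- **The rank-`q` sets of every size**: under the hypotheses of the giant count and `f' + 1 ≤ d`, `q + ν₁ ≤ d + 1`,
`#{X : r(X) = q} ≤ #{X : r(X) = q, |X| ≤ d} + 2^{min f (q + d)}`. -/
theorem ncard_eRk_eq_le_ncard_le_add_two_pow [M.Finite] (q f f' ν₁ νi : ℕ) (hq : 1 ≤ q)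
    (hcirc : ∀ C, M.IsCircuit C → 3 ≤ C.encard) (hC1 : ∀ L ⊆ M.E, M.eRk L = 2 → L.ncard ≤ 3)
    (hC2 : ∀ L ⊆ M.E, M.eRk L ≤ 3 → L.ncard ≤ 6)
    (hflat : ∀ X ⊆ M.E, M.eRk X ≤ q → X.ncard ≤ f)
    (hflat' : ∀ X ⊆ M.E, M.eRk X ≤ (q - 1 : ℕ) → X.ncard ≤ f')
    (hinter : ∀ X ⊆ M.E, M.eRk X ≤ (q - 1 : ℕ) → (X.ncard : ℕ∞) ≤ M.eRk X + νi)
    {d : ℕ} (hd : M.E.encard = M.eRank + d) (h2 : d + νi < 2 * ν₁) (hd1 : f' + 1 ≤ d) (hd2 : q + ν₁ ≤ d + 1) :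
    {X : Set α | X ⊆ M.E ∧ M.eRk X = q}.ncard ≤
      {X : Set α | X ⊆ M.E ∧ M.eRk X = q ∧ X.ncard ≤ d}.ncard + 2 ^ (min f (q + d)) := by
  -- every rank-`q` set has `≤ q + d` points
  have hcap : ∀ X ⊆ M.E, M.eRk X = q → X.ncard ≤ q + d := by
    intro X hX hr
    have h := Matroid.encard_le_eRk_add_of_encard_eq hX hd
    have hXfin : X.Finite := M.ground_finite.subset hX
    rw [hr, ← hXfin.cast_ncard_eq] at h
    exact_mod_cast h
  have hsplit : {X : Set α | X ⊆ M.E ∧ M.eRk X = q} ⊆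
      {X : Set α | X ⊆ M.E ∧ M.eRk X = q ∧ X.ncard ≤ d} ∪
        {X : Set α | X ⊆ M.E ∧ M.eRk X = q ∧ d < X.ncard ∧ X.ncard ≤ q + d} := by
    intro X hX
    by_cases h : X.ncard ≤ d
    · exact Or.inl ⟨hX.1, hX.2, h⟩
    · exact Or.inr ⟨hX.1, hX.2, by omega, hcap X hX.1 hX.2⟩
  have hf1 : {X : Set α | X ⊆ M.E ∧ M.eRk X = q ∧ X.ncard ≤ d}.Finite :=
    M.ground_finite.finite_subsets.subset fun X hX => hX.1
  have hf2 : {X : Set α | X ⊆ M.E ∧ M.eRk X = q ∧ d < X.ncard ∧ X.ncard ≤ q + d}.Finite :=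
    M.ground_finite.finite_subsets.subset fun X hX => hX.1
  have hbig := ncard_eRk_eq_ncard_gt_le_sum_levelF (M := M) q d (q + d)
  have hgiant : ∑ m ∈ Finset.Icc (d + 1) (q + d), (Matroid.levelF M q m).card ≤ 2 ^ (min f (q + d)) := by
    have heq : ∀ m ∈ Finset.Icc (d + 1) (q + d), (Matroid.levelF M q m).card = (levelFGiant M q f' ν₁ m).card := by
      intro m hm
      rw [Finset.mem_Icc] at hm
      exact card_levelF_eq_card_levelFGiant_of_big q f' ν₁ m (by omega) (by omega)
    rw [Finset.sum_congr rfl heq]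
    calc ∑ m ∈ Finset.Icc (d + 1) (q + d), (levelFGiant M q f' ν₁ m).card
        ≤ ∑ m ∈ Finset.Icc (q + 1) (q + d), (levelFGiant M q f' ν₁ m).card := by
          apply Finset.sum_le_sum_of_subset_of_nonneg
          · intro m hm
            rw [Finset.mem_Icc] at hm ⊢
            omega
          · intro m _ _
            exact Nat.zero_le _
      _ ≤ 2 ^ (min f (q + d)) :=
          sum_card_levelFGiant_le_all q f f' ν₁ νi hq hcirc hC1 hC2 hflat hflat' hinter hd h2
  calc {X : Set α | X ⊆ M.E ∧ M.eRk X = q}.ncard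
      ≤ ({X : Set α | X ⊆ M.E ∧ M.eRk X = q ∧ X.ncard ≤ d} ∪
          {X : Set α | X ⊆ M.E ∧ M.eRk X = q ∧ d < X.ncard ∧ X.ncard ≤ q + d}).ncard :=
        Set.ncard_le_ncard hsplit (hf1.union hf2)
    _ ≤ {X : Set α | X ⊆ M.E ∧ M.eRk X = q ∧ X.ncard ≤ d}.ncard +
          {X : Set α | X ⊆ M.E ∧ M.eRk X = q ∧ d < X.ncard ∧ X.ncard ≤ q + d}.ncard := Set.ncard_union_le _ _
    _ ≤ {X : Set α | X ⊆ M.E ∧ M.eRk X = q ∧ X.ncard ≤ d}.ncard + 2 ^ (min f (q + d)) :=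
        Nat.add_le_add_left (hbig.trans hgiant) _

end S2

end PercRepro
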